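/-
Copyright: seat `ym-line-cbag-p2` (prover-ym-line-cbag-p2-g2-0), route `ColdBoxAllGroups`, crux `BulkAllGroups`
(stmt-QuantumFields-22255), line `dlr-chessboard-G` (skeleton `Cruxes/BulkAllGroups/Lines/birth.lean` v5): stub
`stub_kernelCovExpansionG`, the expansion at ONE `β` (everything but the exponent bookkeeping).
-/
import Summits.QuantumFields.YangMills.Theorems.ColdBoxAllGroupsBulkAllGroupsKernelCovDatumCoreG
import Summits.QuantumFields.YangMills.Theorems.ColdBoxAllGroupsBulkAllGroupsDatumPackageDatVecG
import Summits.QuantumFields.YangMills.Theorems.ColdBoxAllGroupsBulkAllGroupsGaussTailDatumG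
import Summits.QuantumFields.YangMills.Theorems.ColdBoxAllGroupsBulkAllGroupsKernelMeanPrelimsG
import Summits.QuantumFields.YangMills.Theorems.ColdBoxAllGroupsBulkAllGroupsKernelMeanTrunkG
import Summits.QuantumFields.YangMills.Theorems.ColdBoxAllGroupsBulkAllGroupsUnitsShiftG
import Summits.QuantumFields.YangMills.Theorems.ColdBoxAllGroupsBulkAllGroupsKernelGoodEventTruncG
import Summits.QuantumFields.YangMills.Theorems.ColdBoxAllGroupsBoxFloorAllGroupsChartDensityJ
import Summits.QuantumFields.YangMills.Theorems.ColdBoxAllGroupsBoxFloorAllGroupsStubBoxDirichletDominationAbsG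
import Summits.QuantumFields.YangMills.Theorems.ColdBoxAllGroupsDefs
import Summits.QuantumFields.YangMills.Theorems.WeakCouplingRatesBulkDominatesColdBoxWNearCentreEdges
import Summits.QuantumFields.YangMills.Theorems.BalabanLadderNTOnePointFloor

/-!
# Crux `BulkAllGroups` (stmt-QuantumFields-22255), line `dlr-chessboard-G`, skeleton v5, stub `stub_kernelCovExpansionG`: the one-scale expansion
# of the deep kernel COVARIANCE with a crude-good datum AT ONE `β`, every compact group presented in `U(N)` — `kernelCovG_sub_interface_le`

The `G`-port of the body of the PROVED `SU(2)` stub `stub_kernelCovExpansion` (`…BulkDominatesColdBoxWStubKernelCovExpansion`), with all bookkeeping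
quantities as free real parameters constrained by explicit inequalities; the registered stub follows in `…StubKernelCovExpansionG` by discharging them
eventually in `β` (`eventually_kernelDatum_boundsG`, p1).  Also `neZero_of_dimE_pos` (positive chart dimension forces `N ≥ 1`).

## The argument (every input is a tree theorem of the line's width seats and leads)

Fix `0 < θ ≤ 1/200`, `δ = θ/5`, `A = θ/20`, `ε = 6θ`; eventually in `β` (all smallness conditions: `eventually_kernelDatum_boundsG`, p1),
`H = ⌈β^θ⌉`, `T = ⌈β^A⌉` (`8T ≤ H`).  For a crude-good datum `ω`:
1. **datum package** (w3, `exists_datum_packageG_datVec`): a gauge `g`, a colour-major chart datum `ϑ` of the forest-fixed truncated gauge copy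
   `W = forestFix H (glueWith E ((ω^g)|_E) 1)` (`W e = expChart ρ (datVec ϑ e)`, `‖datVec ϑ e‖ ≤ r = Ca β^{3θ+δ−1/2}`, `ϑ = 0` on the forest) with
   the energy clause `Σ_c M_{ϑ_c}(s_c) ≤ CE(2H+3)⁴β^{2δ−1}`;
2. **bridge** (w2, `…KernelBridgeG`, `…KernelGoodEventTruncG`): the kernel means of `c_p`, `c_q`, `c_pc_q` and the YM large-field mass are the same
   at `ω` and at `W`; YM rarity `e^{−β^ε}` (`3θ + δ < ε`);
3. **the core at `W`** (lead p2, `abs_kernelCovG_sub_gaussian_le_datum`: T3' ×3 + the `D`-colour moments core), its real inputs discharged by: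
   the link window `linkWindow_subset_image_expChart` (radius `m = 2L`), Helgason's Jacobian `exists_chartMeasureE_restrict_closedBall_eq_withDensity`
   (w2), the tilt bound T4 `abs_tiltWDE_le` + the window coordinates `norm_extDatum_le_of_window` (w2/p1), R3-datum `abs_beta_mul_plaqCostAt_sub_qObsDE_le`
   (w2), the goodTDE sandwich `gaussD_real_compl_goodTDE_inter_ball_le` (w2), the background bound `abs_dirBackground_sdatE_le` (p1);
4. **units** (w3, `…UnitsShiftG`): the core's cross term `Σ_c F'_c(p)F'_c(q)` (scaled background, `√β`) is the interface's
   `2β·Σ_c F̄⁰_c(p)F̄⁰_c(q)` for the half-scaled datum `ϑ⁰ = ϑ/√2`, whose energy clause is `½` the package's (`sum_formM_smul_chartCoords`).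
No sorry; no new definition; no named-fact hypothesis; standard axioms.  NOT a claim about the mass gap: a finite-volume weak-coupling statement
about one Wilson box with a small boundary datum (rung-level support R2xi-G `XiPow`, RECORD label); the Yang–Mills mass gap is NOT proved by this.
-/

set_option autoImplicit false

noncomputable section

open MeasureTheory ProbabilityTheory Finset Real Filter Topology Metric
open scoped ENNReal Matrix.Norms.Frobenius
open Literature.Probability.LatticeModels (Site glueWith)
open Literature.MathematicalPhysics.QuantumLattice
open Literature.MathematicalPhysics.QuantumFieldTheory
open Literature.MathematicalPhysics.QuantumFieldTheory.LatticeMaxwell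
open Literature.MathematicalPhysics.QuantumFieldTheory.AxialGauge
open Summit.QuantumFields.YangMills.Theorems.WeakCouplingRates
open Summit.QuantumFields.YangMills.Theorems.FreeEnergyLogCoefficient

namespace Summit.QuantumFields.YangMills.Theorems.ColdBoxAllGroups

/-! ## Small helpers -/

/-- `(Ca·β^a)² = Ca²·β^{2a}` (`β ≥ 0`). -/
theorem const_mul_rpow_sq {β Ca a : ℝ} (hβ : 0 ≤ β) : (Ca * β ^ a) ^ 2 = Ca ^ 2 * β ^ (2 * a) := by
  rw [mul_pow, show β ^ (2 * a) = (β ^ a) ^ 2 by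
    rw [show (2 : ℝ) * a = a * ((2 : ℕ) : ℝ) by push_cast; ring, Real.rpow_mul_natCast hβ]]

/-- A faithful representation of a group with positive chart dimension has positive degree: `0 < dimE ρ → N ≠ 0`
(two distinct chart points would have equal images in the one-point space `M_0(ℂ)`). -/
theorem neZero_of_dimE_pos {N : ℕ} {G : Type*} [Group G] [TopologicalSpace G] [CompactSpace G] (ρ : G →* Matrix (Fin N) (Fin N) ℂ)
    (hρ : Continuous ρ) (hinj : Function.Injective ρ) (hD : 0 < dimE ρ) : NeZero N := by
  by_contra hN
  have hN0 : N = 0 := by simpa [neZero_iff] using hN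
  subst hN0
  set a : EuclideanSpace ℝ (Fin (dimE ρ)) := PiLp.single 2 (⟨0, hD⟩ : Fin (dimE ρ)) (1 / 8 : ℝ) with ha
  have hna : ‖a‖ = 1 / 8 := by rw [ha, PiLp.norm_single]; norm_num
  have hmem : a ∈ closedBall (0 : EuclideanSpace ℝ (Fin (dimE ρ))) (1 / 4) := by
    rw [mem_closedBall_zero_iff, hna]; norm_num
  have h0mem : (0 : EuclideanSpace ℝ (Fin (dimE ρ))) ∈ closedBall (0 : EuclideanSpace ℝ (Fin (dimE ρ))) (1 / 4) :=
    mem_closedBall_self (by norm_num)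
  have heq : expChart ρ a = expChart ρ 0 := hinj (Subsingleton.elim _ _)
  have ha0 : a = 0 := injOn_expChart ρ hρ hmem h0mem heq
  have : ‖a‖ = 0 := by rw [ha0, norm_zero]
  rw [hna] at this
  norm_num at this

section Box

variable {N : ℕ} {G : Type} [Group G] [TopologicalSpace G] [IsTopologicalGroup G] [CompactSpace G]
  [MeasurableSpace G] [BorelSpace G] [SecondCountableTopology G]
variable (ρ : G →* Matrix (Fin N) (Fin N) ℂ)

omit [TopologicalSpace G] [IsTopologicalGroup G] [CompactSpace G] [MeasurableSpace G] [BorelSpace G] [SecondCountableTopology G] in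
/-- `r ≤ 2·(P·(a + 8r))` for `P ≥ 1`, `a, r ≥ 0` (the exterior radius lies inside the chart ball `m = 2L`). -/
theorem le_chartBall_of_window {P a r : ℝ} (hP : 1 ≤ P) (ha : 0 ≤ a) (hr : 0 ≤ r) : r ≤ 2 * (P * (a + 8 * r)) := by
  nlinarith

set_option maxHeartbeats 800000 in
/-- **The one-scale expansion of the kernel covariance at ONE `β`, every compact group presented in `U(N)`** — the deterministic core with datum
`abs_kernelCovG_sub_gaussian_le_datum` at the forest-fixed truncated gauge copy `W` of a datum `ω` charted by `ϑ` (package data as hypotheses),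
with its Gaussian-window inputs DISCHARGED (T4 `abs_tiltWDE_le`, R3-datum `abs_beta_mul_plaqCostAt_sub_qObsDE_le`, the goodTDE sandwich
`gaussD_real_compl_goodTDE_inter_ball_le`, the background bound `abs_dirBackground_sdatE_le`, window coordinates `norm_extDatum_le_of_window`),
the three kernel integrals TRANSPORTED back to `ω` (`…KernelBridgeG`), and the Gaussian value converted to the interface's units for the
half-scaled datum `ϑ⁰ = ϑ/√2` (`…UnitsShiftG`).  All bookkeeping quantities are free real parameters constrained by explicit inequalities
(discharged eventually in `β` by `eventually_kernelDatum_boundsG`). -/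
theorem kernelCovG_sub_interface_le (hρc : Continuous ρ) (hinj : Function.Injective ρ) (hρu : ∀ g, ρ g ∈ Matrix.unitaryGroup (Fin N) ℂ)
    {β ε r m ℓ B R R' pY : ℝ} {H T : ℕ} (hβ1 : 1 ≤ β) (hH : 1 ≤ H) (h8T : 8 * T ≤ H)
    (ω : LGConfig 4 G) (g : Site 4 → G) {ϑ : Fin (dimE ρ) → (Literature.MathematicalPhysics.QuantumLattice.ZdEdge 4 → ℝ)}
    {s : Fin (dimE ρ) → (DirFree H → ℝ)}
    (hWall : ∀ e, forestFix H (glueWith (boxEdgesAt dirCorner (2 * H + 3))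
      (fun e' : ↥(boxEdgesAt dirCorner (2 * H + 3)) => gaugeTransformZd g ω e'.1) (fun _ => 1)) e = expChart ρ (datVec ϑ e))
    (hr0 : 0 ≤ r) (hϑr : ∀ e, ‖datVec ϑ e‖ ≤ r) (hϑ2 : ∀ e, ∑ c, ϑ c e ^ 2 ≤ r ^ 2)
    (hforest : ∀ x : Site 4, (∀ k : Fin 4, 1 ≤ x k ∧ x k + 1 ≤ 2 * (H : ℤ)) → ∀ c, ϑ c (x, 0) = 0)
    (hE : ∑ c, formM (fun e => e ∉ dirFreeEdges H) dirCorner (2 * H + 3) (ϑ c) (s c) ≤ B)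
    (hpY : (boxKernelG ρ β H (forestFix H (glueWith (boxEdgesAt dirCorner (2 * H + 3))
      (fun e' : ↥(boxEdgesAt dirCorner (2 * H + 3)) => gaugeTransformZd g ω e'.1) (fun _ => 1)))).real (coldGoodSetG ρ H β ε)ᶜ ≤ pY)
    (hpY1 : pY < 1)
    (hrm : r ≤ m) (hm4 : m ≤ 1 / 4)
    (hball : ∀ u : G, ‖ρ u - 1‖ ≤ (12 * (H : ℝ) ^ 2 + 2 * H + 1) * (Real.sqrt 2 * Real.sqrt (β ^ (2 * ε - 1)) + 8 * r) →
      u ∈ expChart ρ '' closedBall (0 : EuclideanSpace ℝ (Fin (dimE ρ))) m)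
    {J : EuclideanSpace ℝ (Fin (dimE ρ)) → ℝ} (hJm : Measurable J) (hgpos : ∀ a, ‖a‖ ≤ m → 0 < J a) (hℓ0 : 0 ≤ ℓ)
    (hg : ∀ a, ‖a‖ ≤ m → |Real.log (J a)| ≤ ℓ) {c : ℝ≥0∞} (hc0 : c ≠ 0) (hctop : c ≠ ∞)
    (hdens : (chartMeasureE ρ (1 / 4)).restrict (closedBall 0 m) =
      (c • (volume : Measure (EuclideanSpace ℝ (Fin (dimE ρ)))).restrict (closedBall 0 m)).withDensity (fun a => ENNReal.ofReal (J a)))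
    (hR0 : 0 ≤ R) (hR' : Real.sqrt (β * B) + 4 * (Real.sqrt β * r) ≤ R')
    (hmEm : Real.sqrt (dimE ρ) * ((12 * (H : ℝ) ^ 2 + 2 * H + 1) * ((R + R') + 4 * (Real.sqrt β * r))) / Real.sqrt β ≤ m)
    (hwin : (dimE ρ : ℝ) / 2 * (R + R') ^ 2 / β + 190 * m ^ 3 < β ^ (2 * ε - 1))
    (hP2 : 240 * (dimE ρ : ℝ) * (2 * (H : ℝ) + 1) ^ 4 * Real.exp (-R ^ 2 / 2) ≤ 1 / 2) :
    |β ^ 2 * ((∫ U, plaqCostAt ρ (boxCentre H) 1 2 U * plaqCostAt ρ (boxCentre H + Pi.single 0 (T : ℤ)) 1 2 U ∂(boxKernelG ρ β H ω)) -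
          (∫ U, plaqCostAt ρ (boxCentre H) 1 2 U ∂(boxKernelG ρ β H ω)) *
            (∫ U, plaqCostAt ρ (boxCentre H + Pi.single 0 (T : ℤ)) 1 2 U ∂(boxKernelG ρ β H ω))) -
        (dimE ρ : ℝ) / 2 * boxDirProjKernel H (boxCentre H, 1, 2) (boxCentre H + Pi.single 0 (T : ℤ), 1, 2) ^ 2 -
        2 * β * (∑ c,
            sCirc (glue (pin := fun e => e ∉ dirFreeEdges H) dirCorner (2 * H + 3) ((1 / Real.sqrt 2) • ϑ c)
                (mean (fun e => e ∉ dirFreeEdges H) dirCorner (2 * H + 3) ((1 / Real.sqrt 2) • ϑ c))) (boxCentre H, 1, 2) *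
              sCirc (glue (pin := fun e => e ∉ dirFreeEdges H) dirCorner (2 * H + 3) ((1 / Real.sqrt 2) • ϑ c)
                (mean (fun e => e ∉ dirFreeEdges H) dirCorner (2 * H + 3) ((1 / Real.sqrt 2) • ϑ c))) (boxCentre H + Pi.single 0 (T : ℤ), 1, 2)) *
          boxDirProjKernel H (boxCentre H, 1, 2) (boxCentre H + Pi.single 0 (T : ℤ), 1, 2)| ≤
      6 * (2 * N * β) * (2 * N * β) * pY +
        (3 * (β ^ (2 * ε)) ^ 2 * (Real.exp (2 * (120 * (2 * (H : ℝ) + 1) ^ 4 * (190 * β * m ^ 3) + 4 * (2 * (H : ℝ) + 1) ^ 4 * ℓ)) - 1) +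
          6 * (β ^ (2 * ε)) ^ 2 * (240 * (dimE ρ : ℝ) * (2 * (H : ℝ) + 1) ^ 4 * Real.exp (-R ^ 2 / 2)) +
          2 * (190 * β * m ^ 3) * (β ^ (2 * ε) + 2 * (dimE ρ : ℝ) * (R' ^ 2 + 2)) +
          Real.sqrt (240 * (dimE ρ : ℝ) * (2 * (H : ℝ) + 1) ^ 4 * Real.exp (-R ^ 2 / 2)) *
            (2 * β ^ (2 * ε) * (2 * (dimE ρ : ℝ) * (R' ^ 2 + 2)) + 3 * (dimE ρ : ℝ) ^ 2 * (R' ^ 4 + 11) +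
              (2 * (dimE ρ : ℝ) * (R' ^ 2 + 2)) ^ 2)) := by
  have hβ0 : 0 < β := by linarith only [hβ1]
  have hT : T ≤ H := le_trans (Nat.le_mul_of_pos_left T (by norm_num)) h8T
  have hR'0 : 0 ≤ R' := le_trans (by positivity) hR'
  have hτ0 : 0 ≤ 190 * β * m ^ 3 := by
    have hm0 : 0 ≤ m := hr0.trans hrm
    positivity
  have hP1 : 240 * (dimE ρ : ℝ) * (2 * (H : ℝ) + 1) ^ 4 * Real.exp (-R ^ 2 / 2) < 1 := by linarith only [hP2]
  -- the truncated gauge copy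
  set W : LGConfig 4 G := forestFix H (glueWith (boxEdgesAt dirCorner (2 * H + 3))
    (fun e' : ↥(boxEdgesAt dirCorner (2 * H + 3)) => gaugeTransformZd g ω e'.1) (fun _ => 1)) with hWdef
  have hW : ∀ e, e ∉ boxEdges 4 (2 * H + 1) → W e = expChart ρ (datVec ϑ e) := fun e _ => hWall e
  have hϑ : ∀ e, e ∉ boxEdges 4 (2 * H + 1) → ‖datVec ϑ e‖ ≤ r := fun e _ => hϑr e
  have hϑ2' : ∀ e, e ∉ boxEdges 4 (2 * H + 1) → ∑ c, ϑ c e ^ 2 ≤ r ^ 2 := fun e _ => hϑ2 e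
  -- ## the background bound (all plaquettes)
  have hF : ∀ (c : Fin (dimE ρ)) (p : ZdPlaquette 4), |sCirc (glue (pin := fun e => e ∉ dirFreeEdges H) dirCorner (2 * H + 3) (sdatE β ϑ c)
      (mean (fun e => e ∉ dirFreeEdges H) dirCorner (2 * H + 3) (sdatE β ϑ c))) (p.1, p.2.1.1, p.2.1.2)| ≤ R' :=
    fun c p => (abs_dirBackground_sdatE_le (H := H) hβ0.le hr0 hϑ2' hforest s hE c p).trans hR'
  -- ## the Gaussian window `S` and its real inputs
  set S : Set (TSpaceD H (dimE ρ)) := goodTDE ρ H β ε ϑ ∩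
    {t | ∀ e, ‖unscaleTE H (dimE ρ) β (t + meanTE H (dimE ρ) β ϑ) e‖ ≤ m} with hSdef
  have hPS : (gaussD H (dimE ρ)).real Sᶜ ≤ 240 * (dimE ρ : ℝ) * (2 * (H : ℝ) + 1) ^ 4 * Real.exp (-R ^ 2 / 2) :=
    gaussD_real_compl_goodTDE_inter_ball_le ρ hρc hβ0 hH hr0 hR0 hR'0 hϑ hforest hF hmEm hrm hm4 hwin
  have hcoord : ∀ t ∈ S, ∀ e, ‖extDatum (datVec ϑ) (unscaleTE H (dimE ρ) β (t + meanTE H (dimE ρ) β ϑ)) e‖ ≤ m :=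
    fun t ht e => norm_extDatum_le_of_window ρ ϑ _ hr0 hrm hϑ2' ht.2 e
  have hWb : ∀ t ∈ S, |tiltWDE ρ H J β ϑ t| ≤ 120 * (2 * (H : ℝ) + 1) ^ 4 * (190 * β * m ^ 3) + 4 * (2 * (H : ℝ) + 1) ^ 4 * ℓ :=
    fun t ht => (abs_tiltWDE_le ρ hρc hβ0 hm4 hg hforest t (hcoord t ht)).trans (tiltSize_le_cardBound H hτ0 hℓ0)
  have hPc := centre_mem_plaquettesTouching hH hT
  have hSur₁ : ∀ t ∈ S, |qObsDE H (dimE ρ) β ϑ (boxCentre H, 1, 2) t - β * plaqCostAt ρ (boxCentre H) 1 2 (cfgTDE ρ H β ϑ t)| ≤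
      190 * β * m ^ 3 := fun t ht => by
    have h := abs_beta_mul_plaqCostAt_sub_qObsDE_le ρ hρc hβ0 hm4 hforest t (hcoord t ht) hPc.1
    rw [abs_sub_comm] at h
    exact h
  have hSur₂ : ∀ t ∈ S, |qObsDE H (dimE ρ) β ϑ (boxCentre H + Pi.single 0 (T : ℤ), 1, 2) t -
      β * plaqCostAt ρ (boxCentre H + Pi.single 0 (T : ℤ)) 1 2 (cfgTDE ρ H β ϑ t)| ≤ 190 * β * m ^ 3 := fun t ht => by
    have h := abs_beta_mul_plaqCostAt_sub_qObsDE_le ρ hρc hβ0 hm4 hforest t (hcoord t ht) hPc.2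
    rw [abs_sub_comm] at h
    exact h
  have hF₁ : ∀ c, |sCirc (glue (pin := fun e => e ∉ dirFreeEdges H) dirCorner (2 * H + 3) (sdatE β ϑ c)
      (mean (fun e => e ∉ dirFreeEdges H) dirCorner (2 * H + 3) (sdatE β ϑ c))) (boxCentre H, 1, 2)| ≤ R' := fun c => by
    have h := hF c ((boxCentre H, ⟨((1 : Fin 4), (2 : Fin 4)), by decide⟩) : ZdPlaquette 4)
    exact h
  have hF₂ : ∀ c, |sCirc (glue (pin := fun e => e ∉ dirFreeEdges H) dirCorner (2 * H + 3) (sdatE β ϑ c)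
      (mean (fun e => e ∉ dirFreeEdges H) dirCorner (2 * H + 3) (sdatE β ϑ c))) (boxCentre H + Pi.single 0 (T : ℤ), 1, 2)| ≤ R' := fun c => by
    have h := hF c ((boxCentre H + Pi.single 0 (T : ℤ), ⟨((1 : Fin 4), (2 : Fin 4)), by decide⟩) : ZdPlaquette 4)
    exact h
  -- ## the core at `W`
  have hcore := abs_kernelCovG_sub_gaussian_le_datum ρ hρc hinj hρu (T := T) hJm hβ1 hH hT hr0 hm4 hW hϑ hball
    hgpos hc0 hctop hdens hpY hpY1 hPS hP1 hWb hτ0 hSur₁ hSur₂ hR'0 hF₁ hF₂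
  -- ## transport of the three kernel integrals from `ω` to `W`
  obtain ⟨hx, hy⟩ := centre_pair_near_centre h8T
  have h12 : (1 : Fin 4) ≠ 2 := by decide
  rw [integral_plaqCostAt_boxKernelG_eq_of_gauge_trunc_of_near_centre ρ hρc β hH ω g hx h12,
    integral_plaqCostAt_boxKernelG_eq_of_gauge_trunc_of_near_centre ρ hρc β hH ω g hy h12,
    integral_plaqCostAt_mul_boxKernelG_eq_of_gauge_trunc_of_near_centre ρ hρc β hH ω g hx hy h12 h12]
  -- ## units: the core's cross term is the interface's
  have hcross : (∑ c, sCirc (glue (pin := fun e => e ∉ dirFreeEdges H) dirCorner (2 * H + 3) (sdatE β ϑ c)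
        (mean (fun e => e ∉ dirFreeEdges H) dirCorner (2 * H + 3) (sdatE β ϑ c))) (boxCentre H, 1, 2) *
      sCirc (glue (pin := fun e => e ∉ dirFreeEdges H) dirCorner (2 * H + 3) (sdatE β ϑ c)
        (mean (fun e => e ∉ dirFreeEdges H) dirCorner (2 * H + 3) (sdatE β ϑ c))) (boxCentre H + Pi.single 0 (T : ℤ), 1, 2)) =
      2 * β * ∑ c, sCirc (glue (pin := fun e => e ∉ dirFreeEdges H) dirCorner (2 * H + 3) ((1 / Real.sqrt 2) • ϑ c)
          (mean (fun e => e ∉ dirFreeEdges H) dirCorner (2 * H + 3) ((1 / Real.sqrt 2) • ϑ c))) (boxCentre H, 1, 2) *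
        sCirc (glue (pin := fun e => e ∉ dirFreeEdges H) dirCorner (2 * H + 3) ((1 / Real.sqrt 2) • ϑ c)
          (mean (fun e => e ∉ dirFreeEdges H) dirCorner (2 * H + 3) ((1 / Real.sqrt 2) • ϑ c))) (boxCentre H + Pi.single 0 (T : ℤ), 1, 2) := by
    simp_rw [dirBackground_sdatE_eq]
    rw [sum_sqrt_smul_mul_eq hβ0.le, beta_sum_dirBackground_mul_eq]
  rw [hcross] at hcore
  have e : ∀ (X Cq V : ℝ), X - (dimE ρ : ℝ) / 2 * Cq ^ 2 - V * Cq = X - ((dimE ρ : ℝ) / 2 * Cq ^ 2 + V * Cq) := fun X Cq V => by ring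
  rw [e]
  exact hcore

end Box

end Summit.QuantumFields.YangMills.Theorems.ColdBoxAllGroups

end
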